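import Summits.QuantumFields.YangMills.Theorems.BalabanUVNodesN11ThmP245OfSect3SupplyRAssumedCoPH
import Summits.QuantumFields.YangMills.Theorems.BalabanUVNodesN11Sect3SupplySplice
import Summits.QuantumFields.YangMills.Theorems.BalabanUVNodesN11FirstStepSupply

/-!
# DAG node N11 — [III]'s p. 244 ASSUMPTION ON 𝐑 × [III] §3's MINIMAL SUPPLY: THEOREM 1 OF [III], `densitiesDescribed`, `Dag.B14_main` AND `B16.Thm1Printed` AT A GENERIC
# v1.7 PARAMETER `θ` FROM EXACTLY `NoExpansionTStepAt θ p k` ∕ `Sect3SpliceSupplyAt θ p k` PER LEVEL AND THE p. 244 OBJECT OF RECORD `ROpLeaf (VOfRecord₁₃CoPH θ p)`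
# (= `B14.RAssumedP244 …` by `Iff.rfl`; = the node's OWN antecedent `(leavesP w p).rOperation` under the carrier binding) — NO live-selector clause, NO admissibility, NO `κ`
# sign; the LEVEL-PREFIX forms; and the level-0 supply RE-KEYED on dag-n08-w2's witness-free `FirstStepSupplyAt θ p` ([I] Thm 1 + [II] at the objects of record)

HEADER — WORK-UNIT METADATA.  Cell `pub-ymgap`, YM-PLAN Track A (HUMAN RULING D-0062 ∕ D-0149 width seats), seat `pub-ymgap-dag-n11-w3` (g2; WIDTH SEAT 3∕4 on NODE n11 [B14],
director-ym №197), route `BalabanUVNodes` (v1.7 `CoPH` key), item K1⁷ `StabilityBAtRecordR13SepCoPH` = stmt-QuantumFields-20542 (helper lane `--kind proof --supports 20542 --as helper`,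
count-neutral).  THE ITEM: dag-n11-e g15's HAND-OUT «w3 take Y» (cell bus 2026-08-27T23:21:49Z): «the p.244-keyed consumer faces of the splice … `sLaw₁₃CoPH_all_of_tStep_of_spliceSupply_of_rOpLeaf`
∕ `b14_main_of_tStep_of_spliceSupply_of_up` ∕ `thm1Printed_datumOfRecord₁₃CoPH_of_tStep_of_spliceSupply_of_rOpLeaf` (one-liners over `sect3SupplyAt_of_spliceSupply`; `0 ≤ E₀, B₀` displayed or
the record's)».  A NEW file rather than an append on this seat's p583556 (400-line cap).  [III] = [Balaban1988Convergent], [IV] = [Balaban1989LargeFieldI], [B16] = [Balaban1989LargeFieldII],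
[I] = [Balaban1987RG1].

THE TWO INGREDIENTS (both in the tree; nothing re-declared here).
(1) THE p. 244 OBJECT (this seat, g0, p583556 `…ThmP245OfSect3SupplyRAssumedCoPH`): [III] p. 244 lines 36–38 — *«The operation 𝐑 serves this purpose. We will not describe it here,
we will only assume that it has some properties incorporated in the inductive description of the effective actions.»* — is, AT THE v1.7 RECORD, `DagBinding.ROpLeaf (VOfRecord₁₃CoPH F N θ p)`
(def-T's 𝐑-carriers of the run), `= B14.RAssumedP244 …` by `Iff.rfl` (`rOpLeaf₁₃CoPH_iff_rAssumedP244`), law form `∀ k < K, TLaw₁₃CoPH θ p k → SLaw₁₃CoPH θ p (k+1)` (`rOpLeaf_VOfRecord₁₃CoPH_iff`);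
p583556 proves Theorem 1 ∕ the node faces from the two per-level deliverables `NoExpansionTStepAt θ p k` (dag-n11-d's lane) and `Sect3SupplyAt θ p k` (dag-n11-e's displayed §3 supply)
plus that object, generic `θ`.
(2) THE MINIMAL SUPPLY (dag-n11-e g15, p586778 `…Sect3SupplySplice` over p585501 `…SpliceDefs`): what a §3 supplier has to PRODUCE is not the whole `Sect3SupplyAt` family with its
bookkeeping but `Sect3SpliceSupplyAt θ p k` — per exposed witness `(t, E_k)` of `ρ_k`'s §2 form, new term values `tnew` (universal in 𝐄) and constants, and AT THE EXPANSION CHILDREN OF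
PRESENT PARENTS ONLY: (O1) the old `𝐁^{(k)}` on the child's `Ũ^c_k(X)` (void at `k = 0`), (O2) r11's new-term obligations + analyticity at `k+1` (= [III] Thm 2's clauses), (O3) the 𝐓-image
clause for the spliced witness (= (3.24)–(3.25) p. 270 ∕ §3 p. 279); ★★★ `sect3SupplyAt_of_spliceSupply : Sect3SpliceSupplyAt θ p k → Sect3SupplyAt θ p k` (`0 ≤ E₀, B₀` only).  At
`k = 0` the minimal supply IS dag-n08-w2's witness-free `FirstStepSupplyAt θ p` (p586913∕p588912 `…FirstStepSupply`: `sect3SpliceSupplyAt_zero_iff_firstStepSupplyAt`; = the explicit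
first-step transport identity `FirstStepIntegralIdentityAt θ p` in def-T's letters, `firstStepSupplyAt_iff_integralIdentity`) — [I] Thm 1 + [II] read at def-T's level-1 objects.

WHAT THIS FILE PROVES (0 `def`, 0 `sorry`, standard axioms; EVERY proof is a face of p583556 composed with `sect3SupplyAt_of_spliceSupply`, at level 0 optionally through
`sect3SpliceSupplyAt_zero_of_firstStepSupply` ∕ `firstStepSupplyAt_iff_integralIdentity`).
§1 PREFIX (generic `θ`; `1 ≤ M`, `0 ≤ B₀, E₀`; no `K`, no proviso): `sLaw₁₃CoPH_le_of_tStep_of_spliceSupply_of_rStep_below` (THEOREM 1 up to level `n` from the two MINIMAL per-level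
   deliverables and the p. 244 steps `TLaw_k → SLaw_{k+1}` BELOW `n`) · `tLaw₁₃CoPH_lt_of_tStep_of_spliceSupply_of_rStep_below` · ★ `sLaw₁₃CoPH_le_of_firstStepSupply_of_spliceSupply_pos_of_rStep_below`
   (the same with the level-0 supply READ AS `FirstStepSupplyAt θ p` and the minimal supply only at `1 ≤ k < n`).
§2 ALL LEVELS (generic `θ`): ★★ `sLaw₁₃CoPH_all_of_tStep_of_spliceSupply_of_rOpLeaf` (THEOREM 1 OF [III], `∀ k ≤ K, SLaw₁₃CoPH θ p k`, from `NoExpansionTStepAt`, `Sect3SpliceSupplyAt` per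
   level and `ROpLeaf (VOfRecord₁₃CoPH θ p)`) · `…_of_rAssumedP244` ([III]'s own name) · `tLaw₁₃CoPH_all_of_tStep_of_spliceSupply_of_rOpLeaf` (the (S1ᵀ) conclusion at every `k < K`).
§3 NODE FACES: `densitiesDescribed_of_tStep_of_spliceSupply_of_rOpLeaf_core` (PROVISO-FREE, any world C-bound to the core's construction) · `densitiesDescribed_of_tStep_of_spliceSupply_of_rOpLeaf`
   (world C-bound to the CoPH datum) · ★★ `b14_main_of_tStep_of_spliceSupply_of_up` (N11's DAG NODE at a world bound to the record in C-binding AND carriers: the 𝐑-antecedent READ FROM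
   THE NODE'S OWN in-edge `(leavesP w p).rOperation`, nothing supplied on the 𝐑-side) · `b14_main_of_tStep_of_spliceSupply_of_rOpLeaf` · ★ `thm1Printed_datumOfRecord₁₃CoPH_of_tStep_of_spliceSupply_of_rOpLeaf`
   ([III] Thm 1 = the route's (B)-face first conjunct at the CoPH datum, per windowed run) · `…_of_rAssumedP244` · `thm1Printed_datumOfRecord₁₃SepCoPH_of_tStep_of_spliceSupply_of_rOpLeaf` (K1⁷'s key).
§4 RECORD (A6 — the p. 244 object HOLDS with zero hypotheses at every H-extension of the witness of record, p540794 `rOpLeaf_VOfRecord₁₃CoPH_theta13LiveOfRecord`; `M = 1`, `0 ≤ B₀, E₀` are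
   the family's numerals): `sLaw₁₃CoPH_le_theta13LiveOfRecordH_of_tStep_of_spliceSupply_below` (Theorem 1 up to `n ≤ K` from the two minimal deliverables below `n`, NOTHING ELSE) ·
   `sLaw₁₃CoPH_le_rePinH_doorCured_theta13LiveOfRecord_of_tStep_of_spliceSupply_below` (at the re-pinned door of K0a's cured witness: level-0 𝐓-step is dag-n11-e's THEOREM) · ★★★
   `sLaw₁₃CoPH_le_rePinH_doorCured_theta13LiveOfRecord_of_firstStepSupply_of_spliceSupply_below` (THEOREM 1 up to `n ≤ K` there from `FirstStepSupplyAt` at level 0 + the minimal supply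
   and the no-expansion 𝐓-steps at the levels `1 ≤ k < n` — nothing else; `n = 1` is n08-w2's p586913 §4) · `…_of_integralIdentity_of_spliceSupply_below` (level 0 as the explicit transport identity).

HONEST FRAMING.  Helper lane, count-neutral KERNEL BOOKKEEPING: compositions of landed theorems; the per-level deliverables `NoExpansionTStepAt` ∕ `Sect3SpliceSupplyAt` ∕ `FirstStepSupplyAt`
([III] Sect. 1, §3, Thm 2, (3.24)–(3.25); [I] Thm 1 + [II] — at the objects of record) and, at generic `θ`, the p. 244 object are DISPLAYED HYPOTHESES, not proved; nothing of Bałaban is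
asserted; N11 is NOT discharged; K1⁷ is NOT closed; counts unmoved (typed 28∕28 · discharged 5∕27).  One finite `𝕋⁴_{L^K}` programme at fixed `ε = L^{−K}`; R4 closes only the
conditional finite-𝕋⁴ rung `BalabanLadder.UV` — NOT ℝ⁴, NOT OS, NOT a mass gap, NOT Clay.  No `sorry`, no `axiom`, no `def`, no `instance`, no `notation`.
Sources: [III] Theorem p.245, p.244 L36–38, (0.2) p.244, Thm 1 p.262, Thm 2 p.263, §2 p.262, §3 p.279, (3.24)–(3.25) p.270, (2.23)–(2.31) pp.258–260, (2.40)–(2.42) p.261, (1.11) p.248;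
[IV] (0.2)–(0.4) p.176, p.177 (i)–(ii); [B16] Thm 1 p.355 (the assumption's source, not exercised); [I] Thm 1 p.258, (0.24)–(0.27) p.257.
-/

noncomputable section

open MeasureTheory
open scoped BigOperators Matrix.Norms.L2Operator

namespace Summit.QuantumFields.YangMills.Theorems.BalabanUVNodesN11ThmP245OfSpliceSupplyRAssumedCoPH

open Literature.MathematicalPhysics.QuantumFieldTheory.Balaban1983to89 T4Continuum Node00 Node00.Tk DagBinding
open Literature.MathematicalPhysics.QuantumFieldTheory.Balaban1983to89.B16RLeafRecord13AtLive (B0_nonneg_theta13LiveOfFamily E0_nonneg_theta13LiveOfFamily)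
open BalabanUVNodesN11Sect3SupplyDefs (Sect3SupplyAt NoExpansionTStepAt)
open BalabanUVNodesN11Sect3SupplySpliceDefs (Sect3SpliceSupplyAt)
open BalabanUVNodesN11Sect3SupplySplice (sect3SupplyAt_of_spliceSupply)
open BalabanUVNodesN11FirstStepSupply (FirstStepSupplyAt FirstStepIntegralIdentityAt sect3SpliceSupplyAt_zero_of_firstStepSupply firstStepSupplyAt_iff_integralIdentity)
open BalabanUVNodesN11RePinnedParamDefs (rePinH)
open BalabanUVNodesN11ThmP245OfSect3SupplyRAssumedCoPH

variable {F : T4Family} {N : ℕ} [NeZero N]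
variable (θ : Stage13HParams F N) (p : B12.RunParams)

/-! ## §1. The level-prefix form: Theorem 1 up to a level `n` from the two MINIMAL per-level deliverables and the 𝐑-steps BELOW `n` -/

section Prefix

/-- **THEOREM 1 UP TO LEVEL `n` FROM THE MINIMAL DELIVERABLES AND THE 𝐑-STEPS BELOW `n` ONLY** (the prefix form of [III] Thm 1's induction, start `Node00.sLaw₁₃CoPH_zero`): for every
`k ≤ n`, `SLaw₁₃CoPH θ p k`, from `NoExpansionTStepAt θ p k`, the MINIMAL supply `Sect3SpliceSupplyAt θ p k` and the p. 244 step `TLaw₁₃CoPH θ p k → SLaw₁₃CoPH θ p (k+1)` at the levels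
`k < n`.  Generic `θ`; `1 ≤ M`, `0 ≤ B₀, E₀`; no `K`, no proviso, no selector clause (p583556 §1 over `sect3SupplyAt_of_spliceSupply`).
[cite: Balaban1988Convergent, Thm 1 p.262, Theorem p.245, p.244 L36–38, (0.2) p.244, §3 p.279, (3.24)–(3.25) p.270] -/
theorem sLaw₁₃CoPH_le_of_tStep_of_spliceSupply_of_rStep_below (hM : 1 ≤ θ.τ9.M) (hB₀ : 0 ≤ θ.s2.lf.B₀) (hE₀ : 0 ≤ θ.s2.lf.E₀) {n : ℕ}
    (hT : ∀ k, k < n → NoExpansionTStepAt θ p k) (hsup : ∀ k, k < n → Sect3SpliceSupplyAt θ p k)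
    (hR : ∀ k, k < n → TLaw₁₃CoPH F N θ p k → SLaw₁₃CoPH F N θ p (k + 1)) :
    ∀ k, k ≤ n → SLaw₁₃CoPH F N θ p k :=
  sLaw₁₃CoPH_le_of_tStep_of_supply_of_rStep_below θ p hM hB₀ hE₀ hT (fun k hk => sect3SupplyAt_of_spliceSupply θ p hE₀ hB₀ (hsup k hk)) hR

/-- **… and the 𝐓-image laws at every level below `n`** (the (S1ᵀ) conclusion `TLaw₁₃CoPH θ p k`, `k < n`, along the prefix, minimal supply).
[cite: Balaban1988Convergent, Theorem p.245, Thm 1 p.262, p.244 L36–38, §3 p.279] -/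
theorem tLaw₁₃CoPH_lt_of_tStep_of_spliceSupply_of_rStep_below (hM : 1 ≤ θ.τ9.M) (hB₀ : 0 ≤ θ.s2.lf.B₀) (hE₀ : 0 ≤ θ.s2.lf.E₀) {n : ℕ}
    (hT : ∀ k, k < n → NoExpansionTStepAt θ p k) (hsup : ∀ k, k < n → Sect3SpliceSupplyAt θ p k)
    (hR : ∀ k, k < n → TLaw₁₃CoPH F N θ p k → SLaw₁₃CoPH F N θ p (k + 1)) :
    ∀ k, k < n → TLaw₁₃CoPH F N θ p k :=
  tLaw₁₃CoPH_lt_of_tStep_of_supply_of_rStep_below θ p hM hB₀ hE₀ hT (fun k hk => sect3SupplyAt_of_spliceSupply θ p hE₀ hB₀ (hsup k hk)) hR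

/-- **★ THEOREM 1 UP TO LEVEL `n`, THE LEVEL-0 SUPPLY READ AS THE WITNESS-FREE FIRST STEP**: for every `k ≤ n`, `SLaw₁₃CoPH θ p k`, from dag-n08-w2's `FirstStepSupplyAt θ p` ([I] Thm 1 +
[II] at def-T's level-1 objects; = `Sect3SpliceSupplyAt θ p 0`, `sect3SpliceSupplyAt_zero_of_firstStepSupply`), the minimal supply `Sect3SpliceSupplyAt θ p k` at the levels `1 ≤ k < n`
ONLY, the no-expansion 𝐓-steps and the p. 244 steps at the levels `k < n`.  Generic `θ`; no `K`, no proviso.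
[cite: Balaban1988Convergent, Thm 1 p.262, Theorem p.245, p.244 L36–38, §3 p.279, (3.24)–(3.25) p.270; Balaban1987RG1, Thm 1 p.258] -/
theorem sLaw₁₃CoPH_le_of_firstStepSupply_of_spliceSupply_pos_of_rStep_below (hM : 1 ≤ θ.τ9.M) (hB₀ : 0 ≤ θ.s2.lf.B₀) (hE₀ : 0 ≤ θ.s2.lf.E₀) {n : ℕ}
    (hT : ∀ k, k < n → NoExpansionTStepAt θ p k) (h0 : FirstStepSupplyAt θ p) (hsup : ∀ k, 0 < k → k < n → Sect3SpliceSupplyAt θ p k)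
    (hR : ∀ k, k < n → TLaw₁₃CoPH F N θ p k → SLaw₁₃CoPH F N θ p (k + 1)) :
    ∀ k, k ≤ n → SLaw₁₃CoPH F N θ p k :=
  sLaw₁₃CoPH_le_of_tStep_of_spliceSupply_of_rStep_below θ p hM hB₀ hE₀ hT
    (fun k hk => by
      rcases Nat.eq_zero_or_pos k with rfl | hk0
      · exact sect3SpliceSupplyAt_zero_of_firstStepSupply θ p h0
      · exact hsup k hk0 hk)
    hR

end Prefix

/-! ## §2. All levels: THEOREM 1 OF [III] from the two minimal per-level deliverables and the p. 244 object of record `ROpLeaf (VOfRecord₁₃CoPH θ p)` -/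

section AllLevels

/-- **★★ THEOREM 1 OF [III] AT `θ`, ALL LEVELS, ALL HISTORIES — `∀ k ≤ K, SLaw₁₃CoPH θ p k` — FROM `NoExpansionTStepAt`, THE MINIMAL SUPPLY `Sect3SpliceSupplyAt` PER LEVEL AND
[III]'s p. 244 ASSUMPTION AT THE RECORD** (`hR : ROpLeaf (VOfRecord₁₃CoPH θ p)`, node N13's product by name).  Generic `θ`: NO selector clause, NO admissibility, NO `κ` sign — compare
dag-n11-e's `…Sect3SupplySplice.sLaw₁₃CoPH_all_of_tStep_of_spliceSupply_of_liveSel`, which runs the 𝐑-side on the live-selector line instead.  (dag-n11-e g15's hand-out «Y», name 1.)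
[cite: Balaban1988Convergent, Thm 1 p.262, Theorem p.245, p.244 L36–38, Thm 2 p.263, §3 p.279; Balaban1989LargeFieldII, Thm 1 p.355 (the assumption's source, not exercised)] -/
theorem sLaw₁₃CoPH_all_of_tStep_of_spliceSupply_of_rOpLeaf (hM : 1 ≤ θ.τ9.M) (hB₀ : 0 ≤ θ.s2.lf.B₀) (hE₀ : 0 ≤ θ.s2.lf.E₀)
    (hT : ∀ k, k < p.K → NoExpansionTStepAt θ p k) (hsup : ∀ k, k < p.K → Sect3SpliceSupplyAt θ p k) (hR : ROpLeaf (VOfRecord₁₃CoPH F N θ p)) :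
    ∀ k, k ≤ p.K → SLaw₁₃CoPH F N θ p k :=
  sLaw₁₃CoPH_all_of_tStep_of_supply_of_rOpLeaf θ p hM hB₀ hE₀ hT (fun k hk => sect3SupplyAt_of_spliceSupply θ p hE₀ hB₀ (hsup k hk)) hR

/-- **THEOREM 1 OF [III] AT `θ` FROM THE TWO MINIMAL DELIVERABLES AND THE p. 244 SENTENCE IN [III]'s OWN NAME** — `B14.RAssumedP244` at the 𝐑-carriers of record.
[cite: Balaban1988Convergent, p.244 L36–38, Thm 1 p.262, Theorem p.245, §3 p.279] -/
theorem sLaw₁₃CoPH_all_of_tStep_of_spliceSupply_of_rAssumedP244 (hM : 1 ≤ θ.τ9.M) (hB₀ : 0 ≤ θ.s2.lf.B₀) (hE₀ : 0 ≤ θ.s2.lf.E₀)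
    (hT : ∀ k, k < p.K → NoExpansionTStepAt θ p k) (hsup : ∀ k, k < p.K → Sect3SpliceSupplyAt θ p k)
    (hR : B14.RAssumedP244 (VOfRecord₁₃CoPH F N θ p).R (VOfRecord₁₃CoPH F N θ p).Scorr (VOfRecord₁₃CoPH F N θ p).S p.K) :
    ∀ k, k ≤ p.K → SLaw₁₃CoPH F N θ p k :=
  sLaw₁₃CoPH_all_of_tStep_of_supply_of_rAssumedP244 θ p hM hB₀ hE₀ hT (fun k hk => sect3SupplyAt_of_spliceSupply θ p hE₀ hB₀ (hsup k hk)) hR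

/-- **… hence the 𝐓-image laws at EVERY level `k < K`** (the (S1ᵀ) conclusion all along the run, minimal supply, p. 244 object).
[cite: Balaban1988Convergent, Theorem p.245, Thm 1 p.262, p.244 L36–38, §3 p.279] -/
theorem tLaw₁₃CoPH_all_of_tStep_of_spliceSupply_of_rOpLeaf (hM : 1 ≤ θ.τ9.M) (hB₀ : 0 ≤ θ.s2.lf.B₀) (hE₀ : 0 ≤ θ.s2.lf.E₀)
    (hT : ∀ k, k < p.K → NoExpansionTStepAt θ p k) (hsup : ∀ k, k < p.K → Sect3SpliceSupplyAt θ p k) (hR : ROpLeaf (VOfRecord₁₃CoPH F N θ p)) :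
    ∀ k, k < p.K → TLaw₁₃CoPH F N θ p k :=
  tLaw₁₃CoPH_all_of_tStep_of_supply_of_rOpLeaf θ p hM hB₀ hE₀ hT (fun k hk => sect3SupplyAt_of_spliceSupply θ p hE₀ hB₀ (hsup k hk)) hR

end AllLevels

/-! ## §3. The node faces with the p. 244 object displayed and the minimal supply: `densitiesDescribed`, `Dag.B14_main` (𝐑 from the node's OWN in-edge), `B16.Thm1Printed` -/

section Node

/-- **★ N11's NODE SENTENCE `densitiesDescribed` — PROVISO-FREE — at ANY world whose C-binding is the CoPH core's construction over the densities of record**, from `NoExpansionTStepAt`,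
the minimal supply per level and the p. 244 object.  Generic `θ`; no `Provisos₁₃CoPH`, no selector clause.
[cite: Balaban1988Convergent, Thm 1 p.262, Theorem p.245, p.244 L36–38, §3 p.279] -/
theorem densitiesDescribed_of_tStep_of_spliceSupply_of_rOpLeaf_core (hM : 1 ≤ θ.τ9.M) (hB₀ : 0 ≤ θ.s2.lf.B₀) (hE₀ : 0 ≤ θ.s2.lf.E₀)
    (hT : ∀ k, k < p.K → NoExpansionTStepAt θ p k) (hsup : ∀ k, k < p.K → Sect3SpliceSupplyAt θ p k) (hR : ROpLeaf (VOfRecord₁₃CoPH F N θ p))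
    (w : WorldP) (hC : w.C = (coreOfRecord₁₃CoPH F N θ).construction (densOfRecord₁₃ F N θ.toStage13Params)) :
    (leavesP w p).densitiesDescribed :=
  densitiesDescribed_of_tStep_of_supply_of_rOpLeaf_core θ p hM hB₀ hE₀ hT (fun k hk => sect3SupplyAt_of_spliceSupply θ p hE₀ hB₀ (hsup k hk)) hR w hC

/-- **N11's NODE SENTENCE `densitiesDescribed` AT A WORLD BOUND TO THE CoPH DATUM OF `θ`** (`w.C = (datumOfRecord₁₃CoPH θ h).C`), from `NoExpansionTStepAt`, the minimal supply per level
and the p. 244 object; `h` is only the datum's key. [cite: Balaban1988Convergent, Thm 1 p.262, Theorem p.245, p.244 L36–38, §3 p.279] -/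
theorem densitiesDescribed_of_tStep_of_spliceSupply_of_rOpLeaf (h : θ.Provisos₁₃CoPH F N) (hM : 1 ≤ θ.τ9.M) (hB₀ : 0 ≤ θ.s2.lf.B₀) (hE₀ : 0 ≤ θ.s2.lf.E₀)
    (hT : ∀ k, k < p.K → NoExpansionTStepAt θ p k) (hsup : ∀ k, k < p.K → Sect3SpliceSupplyAt θ p k) (hR : ROpLeaf (VOfRecord₁₃CoPH F N θ p))
    (w : WorldP) (hC : w.C = (datumOfRecord₁₃CoPH F N θ h).C) :
    (leavesP w p).densitiesDescribed :=
  densitiesDescribed_of_tStep_of_supply_of_rOpLeaf θ p h hM hB₀ hE₀ hT (fun k hk => sect3SupplyAt_of_spliceSupply θ p hE₀ hB₀ (hsup k hk)) hR w hC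

/-- **★★ N11's DAG NODE `Dag.B14_main (leavesP w p)` AT A WORLD BOUND TO THE RECORD IN ITS C-BINDING AND ITS CARRIERS, THE 𝐑-ANTECEDENT READ FROM THE NODE'S OWN IN-EDGE, THE
SUPPLY MINIMAL**: at `w.C = (datumOfRecord₁₃CoPH θ h).C` and `w.up p = upOfRecord₅C (θ.toStage5₁₃CoPH) p` the node's hypothesis `(leavesP w p).rOperation` IS `ROpLeaf (VOfRecord₁₃CoPH θ p)`
(`Iff.rfl` behind the binding) — what [III] p. 244 assumes of 𝐑 — so the node follows from `NoExpansionTStepAt` and `Sect3SpliceSupplyAt` per level with NOTHING supplied on the 𝐑-side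
(the other in-edges `b7 … b11`, `smallCouplings`, `smallFieldInductive`, `flowControl` are not read).  (dag-n11-e g15's hand-out «Y», name 2.)
[cite: Balaban1988Convergent, Thm 1 p.262, Theorem p.245, p.244 L36–38, Thm 2 p.263, §3 p.279; Balaban1989LargeFieldII, Thm 1 p.355 (the in-edge's source)] -/
theorem b14_main_of_tStep_of_spliceSupply_of_up (h : θ.Provisos₁₃CoPH F N) (hM : 1 ≤ θ.τ9.M) (hB₀ : 0 ≤ θ.s2.lf.B₀) (hE₀ : 0 ≤ θ.s2.lf.E₀)
    (hT : ∀ k, k < p.K → NoExpansionTStepAt θ p k) (hsup : ∀ k, k < p.K → Sect3SpliceSupplyAt θ p k)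
    (w : WorldP) (hC : w.C = (datumOfRecord₁₃CoPH F N θ h).C) (hup : w.up p = upOfRecord₅C F N (θ.toStage5₁₃CoPH F N) p) :
    Dag.B14_main (leavesP w p) :=
  b14_main_of_tStep_of_supply_of_up θ p h hM hB₀ hE₀ hT (fun k hk => sect3SupplyAt_of_spliceSupply θ p hE₀ hB₀ (hsup k hk)) w hC hup

/-- **N11's DAG NODE `Dag.B14_main (leavesP w p)` AT A WORLD BOUND TO THE CoPH DATUM, the p. 244 object displayed, the supply minimal** (`hR : ROpLeaf (VOfRecord₁₃CoPH θ p)` instead of the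
carrier binding). [cite: Balaban1988Convergent, Thm 1 p.262, Theorem p.245, p.244 L36–38, §3 p.279] -/
theorem b14_main_of_tStep_of_spliceSupply_of_rOpLeaf (h : θ.Provisos₁₃CoPH F N) (hM : 1 ≤ θ.τ9.M) (hB₀ : 0 ≤ θ.s2.lf.B₀) (hE₀ : 0 ≤ θ.s2.lf.E₀)
    (hT : ∀ k, k < p.K → NoExpansionTStepAt θ p k) (hsup : ∀ k, k < p.K → Sect3SpliceSupplyAt θ p k) (hR : ROpLeaf (VOfRecord₁₃CoPH F N θ p))
    (w : WorldP) (hC : w.C = (datumOfRecord₁₃CoPH F N θ h).C) :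
    Dag.B14_main (leavesP w p) :=
  b14_main_of_tStep_of_supply_of_rOpLeaf θ p h hM hB₀ hE₀ hT (fun k hk => sect3SupplyAt_of_spliceSupply θ p hE₀ hB₀ (hsup k hk)) hR w hC

/-- **★ `B16.Thm1Printed (datumOfRecord₁₃CoPH θ h).C` — [III] THEOREM 1 AT THE CoPH DATUM OF `θ` (the route's (B)-face first conjunct) FROM `NoExpansionTStepAt`, THE MINIMAL SUPPLY
AND THE p. 244 OBJECT ALONG EVERY WINDOWED RUN** (def-T's `thm1Printed_datumOfRecord₁₃CoPH_of_tLaw_rOpLeaf` behind p583556; the leaf DISPLAYED per run).  Generic `θ`; `h` is only the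
datum's key.  (dag-n11-e g15's hand-out «Y», name 3.) [cite: Balaban1988Convergent, Thm 1 p.262, Theorem p.245, p.244 L36–38, Thm 2 p.263, §3 p.279; Balaban1989LargeFieldII, Thm 1 p.355 (not exercised)] -/
theorem thm1Printed_datumOfRecord₁₃CoPH_of_tStep_of_spliceSupply_of_rOpLeaf (h : θ.Provisos₁₃CoPH F N) (hM : 1 ≤ θ.τ9.M) (hB₀ : 0 ≤ θ.s2.lf.B₀) (hE₀ : 0 ≤ θ.s2.lf.E₀)
    {γ : ℝ} (hγ : 0 < γ)
    (hT : ∀ P : B12.RunParams, ((datumOfRecord₁₃CoPH F N θ h).C P).flow.InInterval γ P.K → ∀ k, k < P.K → NoExpansionTStepAt θ P k)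
    (hsup : ∀ P : B12.RunParams, ((datumOfRecord₁₃CoPH F N θ h).C P).flow.InInterval γ P.K → ∀ k, k < P.K → Sect3SpliceSupplyAt θ P k)
    (hR : ∀ P : B12.RunParams, ((datumOfRecord₁₃CoPH F N θ h).C P).flow.InInterval γ P.K → ROpLeaf (VOfRecord₁₃CoPH F N θ P)) :
    B16.Thm1Printed (datumOfRecord₁₃CoPH F N θ h).C :=
  thm1Printed_datumOfRecord₁₃CoPH_of_tStep_of_supply_of_rOpLeaf θ h hM hB₀ hE₀ hγ hT
    (fun P hP k hk => sect3SupplyAt_of_spliceSupply θ P hE₀ hB₀ (hsup P hP k hk)) hR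

/-- **`B16.Thm1Printed` AT THE CoPH DATUM FROM `NoExpansionTStepAt`, THE MINIMAL SUPPLY AND THE p. 244 SENTENCE IN [III]'s OWN NAME** (`B14.RAssumedP244` at the 𝐑-carriers of record,
per windowed run). [cite: Balaban1988Convergent, p.244 L36–38, Thm 1 p.262, Theorem p.245, §3 p.279; Balaban1989LargeFieldII, Thm 1 p.355 (not exercised)] -/
theorem thm1Printed_datumOfRecord₁₃CoPH_of_tStep_of_spliceSupply_of_rAssumedP244 (h : θ.Provisos₁₃CoPH F N) (hM : 1 ≤ θ.τ9.M) (hB₀ : 0 ≤ θ.s2.lf.B₀) (hE₀ : 0 ≤ θ.s2.lf.E₀)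
    {γ : ℝ} (hγ : 0 < γ)
    (hT : ∀ P : B12.RunParams, ((datumOfRecord₁₃CoPH F N θ h).C P).flow.InInterval γ P.K → ∀ k, k < P.K → NoExpansionTStepAt θ P k)
    (hsup : ∀ P : B12.RunParams, ((datumOfRecord₁₃CoPH F N θ h).C P).flow.InInterval γ P.K → ∀ k, k < P.K → Sect3SpliceSupplyAt θ P k)
    (hR : ∀ P : B12.RunParams, ((datumOfRecord₁₃CoPH F N θ h).C P).flow.InInterval γ P.K →
      B14.RAssumedP244 (VOfRecord₁₃CoPH F N θ P).R (VOfRecord₁₃CoPH F N θ P).Scorr (VOfRecord₁₃CoPH F N θ P).S P.K) :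
    B16.Thm1Printed (datumOfRecord₁₃CoPH F N θ h).C :=
  thm1Printed_datumOfRecord₁₃CoPH_of_tStep_of_supply_of_rAssumedP244 θ h hM hB₀ hE₀ hγ hT
    (fun P hP k hk => sect3SupplyAt_of_spliceSupply θ P hE₀ hB₀ (hsup P hP k hk)) hR

/-- **`B16.Thm1Printed` AT THE v1.7 SEPARATED-RANGE DATUM `datumOfRecord₁₃SepCoPH θ h`** (`h : Provisos₁₃SepCoPH`, the K1⁷ item's key; `= datumOfRecord₁₃CoPH θ h.toCore` by `rfl`) from
`NoExpansionTStepAt`, the minimal supply and the p. 244 object per windowed run. [cite: Balaban1988Convergent, p.244 L36–38, Thm 1 p.262, Theorem p.245, §3 p.279; Balaban1989LargeFieldII, Thm 1 p.355 (not exercised)] -/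
theorem thm1Printed_datumOfRecord₁₃SepCoPH_of_tStep_of_spliceSupply_of_rOpLeaf (h : θ.Provisos₁₃SepCoPH F N) (hM : 1 ≤ θ.τ9.M) (hB₀ : 0 ≤ θ.s2.lf.B₀) (hE₀ : 0 ≤ θ.s2.lf.E₀)
    {γ : ℝ} (hγ : 0 < γ)
    (hT : ∀ P : B12.RunParams, ((datumOfRecord₁₃SepCoPH F N θ h).C P).flow.InInterval γ P.K → ∀ k, k < P.K → NoExpansionTStepAt θ P k)
    (hsup : ∀ P : B12.RunParams, ((datumOfRecord₁₃SepCoPH F N θ h).C P).flow.InInterval γ P.K → ∀ k, k < P.K → Sect3SpliceSupplyAt θ P k)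
    (hR : ∀ P : B12.RunParams, ((datumOfRecord₁₃SepCoPH F N θ h).C P).flow.InInterval γ P.K → ROpLeaf (VOfRecord₁₃CoPH F N θ P)) :
    B16.Thm1Printed (datumOfRecord₁₃SepCoPH F N θ h).C :=
  thm1Printed_datumOfRecord₁₃CoPH_of_tStep_of_spliceSupply_of_rOpLeaf θ h.toCore hM hB₀ hE₀ hγ hT hsup hR

end Node

/-! ## §4. A6 — the p. 244 object is inhabited where the tree says so: the prefix forms at the witness of record and at the re-pinned door of its cured family, minimal supply -/

section Record

variable (F N)
variable (Zr : (q : B12.RunParams) → TkResidualW F N (FluctV N) q.K) (Zh : (q : B12.RunParams) → ℕ → (ℕ → Set (Site (F.P q.K) 0)) → (ℕ → Set (Site (F.P q.K) 0)) → TkResidualW F N (FluctV N) q.K)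
  (Phih : (q : B12.RunParams) → ℕ → (ℕ → Set (Site (F.P q.K) 0)) → (ℕ → Set (Site (F.P q.K) 0)) → (ℕ → Plaq (F.P q.K) 0 → ℝ))

/-- **★★ THEOREM 1 UP TO LEVEL `n ≤ K` AT ANY H-EXTENSION `⟨⟨θ₁₃, Zr⟩, Zh, Phih⟩` OF THE WITNESS OF RECORD `θ₁₃ = theta13LiveOfRecord F N` FROM THE TWO MINIMAL DELIVERABLES BELOW
`n` ONLY**: there the p. 244 object HOLDS with zero hypotheses (p540794 `rOpLeaf_VOfRecord₁₃CoPH_theta13LiveOfRecord`), `M = 1` and `0 ≤ B₀, E₀` are the family's numerals — so §1 reads: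
`∀ k ≤ n, SLaw₁₃CoPH … p k` from `NoExpansionTStepAt` ∕ `Sect3SpliceSupplyAt` at the levels `k < n` (`n = K` is dag-n11-e's `…Sect3SupplySplice.sLaw₁₃CoPH_all_theta13LiveOfRecordH_of_tStep_of_spliceSupply`).
[cite: Balaban1988Convergent, Thm 1 p.262, Theorem p.245, p.244 L36–38, §3 p.279, (3.24)–(3.25) p.270; Balaban1989LargeFieldI, (0.3)–(0.4) p.176, p.177 (i)–(ii)] -/
theorem sLaw₁₃CoPH_le_theta13LiveOfRecordH_of_tStep_of_spliceSupply_below {n : ℕ} (hn : n ≤ p.K)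
    (hT : ∀ k, k < n → NoExpansionTStepAt (⟨⟨theta13LiveOfRecord F N, Zr⟩, Zh, Phih⟩ : Stage13HParams F N) p k)
    (hsup : ∀ k, k < n → Sect3SpliceSupplyAt (⟨⟨theta13LiveOfRecord F N, Zr⟩, Zh, Phih⟩ : Stage13HParams F N) p k) :
    ∀ k, k ≤ n → SLaw₁₃CoPH F N (⟨⟨theta13LiveOfRecord F N, Zr⟩, Zh, Phih⟩ : Stage13HParams F N) p k :=
  sLaw₁₃CoPH_le_theta13LiveOfRecordH_of_tStep_of_supply_below F N p Zr Zh Phih hn hT fun k hk =>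
    sect3SupplyAt_of_spliceSupply _ p
      (E0_nonneg_theta13LiveOfFamily F N eps0OfRecord₁₃ (zeta316OfRecord F N (numerics7OfFamily eps0OfRecord₁₃) 1 1) (RzOfRecord F N) (ZtOfRecord F N))
      (B0_nonneg_theta13LiveOfFamily F N eps0OfRecord₁₃ (zeta316OfRecord F N (numerics7OfFamily eps0OfRecord₁₃) 1 1) (RzOfRecord F N) (ZtOfRecord F N)) (hsup k hk)

/-- **★★ THEOREM 1 UP TO LEVEL `n ≤ K` AT THE RE-PINNED DOOR OF K0a's CURED WITNESS OF RECORD FROM THE MINIMAL SUPPLY AT THE LEVELS `< n` AND THE NO-EXPANSION 𝐓-STEPS AT THE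
LEVELS `1 ≤ k < n` — NOTHING ELSE** (p583556 §4: the door is an H-extension of the witness of record by `rfl`; the level-0 no-expansion 𝐓-step there is dag-n11-e's THEOREM
`noExpansionTStepAt_rePinH_doorCured_theta13LiveOfRecord_zero`).  `n = 1`: p586778's `sLaw₁₃CoPH_one_rePinH_doorCured_theta13LiveOfRecord_of_spliceSupply_zero`.
[cite: Balaban1988Convergent, Thm 1 p.262, Theorem p.245, p.244 L36–38, §3 p.279, (3.24)–(3.25) p.270, (1.11) p.248; Balaban1989LargeFieldI, (0.3)–(0.4) p.176] -/
theorem sLaw₁₃CoPH_le_rePinH_doorCured_theta13LiveOfRecord_of_tStep_of_spliceSupply_below {n : ℕ} (hn : n ≤ p.K)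
    (hT : ∀ k, 0 < k → k < n → NoExpansionTStepAt (rePinH (Stage13HParams.ofHistoryBlind F N (Stage13RParams.ofCured F N (theta13LiveOfRecord F N)))) p k)
    (hsup : ∀ k, k < n → Sect3SpliceSupplyAt (rePinH (Stage13HParams.ofHistoryBlind F N (Stage13RParams.ofCured F N (theta13LiveOfRecord F N)))) p k) :
    ∀ k, k ≤ n → SLaw₁₃CoPH F N (rePinH (Stage13HParams.ofHistoryBlind F N (Stage13RParams.ofCured F N (theta13LiveOfRecord F N)))) p k :=
  sLaw₁₃CoPH_le_rePinH_doorCured_theta13LiveOfRecord_of_tStep_of_supply_below F N p hn hT fun k hk =>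
    sect3SupplyAt_of_spliceSupply _ p
      (E0_nonneg_theta13LiveOfFamily F N eps0OfRecord₁₃ (zeta316OfRecord F N (numerics7OfFamily eps0OfRecord₁₃) 1 1) (RzOfRecord F N) (ZtOfRecord F N))
      (B0_nonneg_theta13LiveOfFamily F N eps0OfRecord₁₃ (zeta316OfRecord F N (numerics7OfFamily eps0OfRecord₁₃) 1 1) (RzOfRecord F N) (ZtOfRecord F N)) (hsup k hk)

/-- **★★★ THEOREM 1 UP TO LEVEL `n ≤ K` AT THE RE-PINNED DOOR OF THE CURED WITNESS OF RECORD FROM THE WITNESS-FREE FIRST STEP AT LEVEL 0, AND THE MINIMAL SUPPLY AND THE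
NO-EXPANSION 𝐓-STEPS AT THE LEVELS `1 ≤ k < n` — NOTHING ELSE**: `∀ k ≤ n, SLaw₁₃CoPH … p k` from dag-n08-w2's `FirstStepSupplyAt … p` ([I] Thm 1 + [II] at def-T's level-1 objects of
that parameter), `Sect3SpliceSupplyAt … p k` and `NoExpansionTStepAt … p k` for `1 ≤ k < n`.  The 𝐑-steps, the level-0 𝐓-step, `M = 1` and the signs are the tree's theorems there.
`n = 1`: no level-`≥ 1` hypothesis at all — dag-n08-w2's p586913 `sLaw₁₃CoPH_one_rePinH_doorCured_theta13LiveOfRecord_of_firstStepSupply`.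
[cite: Balaban1988Convergent, Thm 1 p.262, Theorem p.245, p.244 L36–38, Thm 2 p.263, §3 p.279, (3.24)–(3.25) p.270; Balaban1987RG1, Thm 1 p.258; Balaban1989LargeFieldI, (0.3)–(0.4) p.176] -/
theorem sLaw₁₃CoPH_le_rePinH_doorCured_theta13LiveOfRecord_of_firstStepSupply_of_spliceSupply_below {n : ℕ} (hn : n ≤ p.K)
    (h0 : FirstStepSupplyAt (rePinH (Stage13HParams.ofHistoryBlind F N (Stage13RParams.ofCured F N (theta13LiveOfRecord F N)))) p)
    (hT : ∀ k, 0 < k → k < n → NoExpansionTStepAt (rePinH (Stage13HParams.ofHistoryBlind F N (Stage13RParams.ofCured F N (theta13LiveOfRecord F N)))) p k)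
    (hsup : ∀ k, 0 < k → k < n → Sect3SpliceSupplyAt (rePinH (Stage13HParams.ofHistoryBlind F N (Stage13RParams.ofCured F N (theta13LiveOfRecord F N)))) p k) :
    ∀ k, k ≤ n → SLaw₁₃CoPH F N (rePinH (Stage13HParams.ofHistoryBlind F N (Stage13RParams.ofCured F N (theta13LiveOfRecord F N)))) p k :=
  sLaw₁₃CoPH_le_rePinH_doorCured_theta13LiveOfRecord_of_tStep_of_spliceSupply_below F N p hn hT fun k hk => by
    rcases Nat.eq_zero_or_pos k with rfl | hk0
    · exact sect3SpliceSupplyAt_zero_of_firstStepSupply _ p h0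
    · exact hsup k hk0 hk

/-- **THE SAME WITH LEVEL 0 READ AS THE EXPLICIT FIRST-STEP TRANSPORT IDENTITY IN def-T's LETTERS** (dag-n08-w2's `FirstStepIntegralIdentityAt`, `firstStepSupplyAt_iff_integralIdentity`):
Theorem 1 up to `n ≤ K` at the re-pinned door of the cured witness of record from `𝐓ρ₀ = 𝐓₁ exp A₁` (with Thm-2-type clauses for the first-step terms) at level 0 and the minimal supply +
no-expansion 𝐓-steps at `1 ≤ k < n`. [cite: Balaban1988Convergent, Thm 1 p.262, Theorem p.245, (3.1) p.264, (3.24)–(3.25) p.270, §3 p.279; Balaban1987RG1, Thm 1 p.258, (0.24)–(0.27) p.257] -/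
theorem sLaw₁₃CoPH_le_rePinH_doorCured_theta13LiveOfRecord_of_integralIdentity_of_spliceSupply_below {n : ℕ} (hn : n ≤ p.K)
    (h0 : FirstStepIntegralIdentityAt (rePinH (Stage13HParams.ofHistoryBlind F N (Stage13RParams.ofCured F N (theta13LiveOfRecord F N)))) p)
    (hT : ∀ k, 0 < k → k < n → NoExpansionTStepAt (rePinH (Stage13HParams.ofHistoryBlind F N (Stage13RParams.ofCured F N (theta13LiveOfRecord F N)))) p k)
    (hsup : ∀ k, 0 < k → k < n → Sect3SpliceSupplyAt (rePinH (Stage13HParams.ofHistoryBlind F N (Stage13RParams.ofCured F N (theta13LiveOfRecord F N)))) p k) :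
    ∀ k, k ≤ n → SLaw₁₃CoPH F N (rePinH (Stage13HParams.ofHistoryBlind F N (Stage13RParams.ofCured F N (theta13LiveOfRecord F N)))) p k :=
  sLaw₁₃CoPH_le_rePinH_doorCured_theta13LiveOfRecord_of_firstStepSupply_of_spliceSupply_below F N p hn ((firstStepSupplyAt_iff_integralIdentity _ p).mpr h0) hT hsup

end Record

end Summit.QuantumFields.YangMills.Theorems.BalabanUVNodesN11ThmP245OfSpliceSupplyRAssumedCoPH

end
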